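import Summits.AtomisticToContinuum.HydrodynamicLimit.Theorems.ImplosionDichotomyHydroLimitInBandSignedBandDefs
import HarnessLib

/-!
# Guard-relativised inputs of the in-band entropy clock — statements (line `IdeatorOneSketch`, crux
# `HydroLimitProfilewiseBand`, stmt-AtomisticToContinuum-17372; support file, `--supports` it)

The registered skeleton of the line (`Cruxes/HydroLimitProfilewiseBand/Lines/IdeatorOneSketch.lean`, v18) closes the crux modulo
the kinetic input `stub_kcwuSharpPlus` and `stub_items4 = SEET (stmt-17701) ∧ LCTF (stmt-17691) ∧ EAT (stmt-17703) ∧ CAT (stmt-13734)`.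
The three TRUE-LAW tail inputs SEET / EAT / CAT are typed WITHOUT a packing guard (every tied classical hs-Euler solution, however
dense it becomes before `T`), whereas their only consumers — the guarded in-band clock of `HydroLimitInBand` (stmt-9133), this crux, and
the dock `ClampedTransferDockOfInputsQ` (stmt-18054) — instantiate them along ONE solution that obeys the packing guard
`ρ_t(x) σ³ < η` on `[0, T)`.  The crux-strategist of stmt-13734 asked the tenure planner to RESTATE CAT as its guard-relativised
form CAT_η (`Cruxes/CollisionActivityTails/RESTATE-SPLIT-REQUEST.md`, text `CAT_eta.txt`), conditionally on a re-check that the heart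
composes from CAT_η.  Skeleton v19 of this line performs that re-check in the kernel: it RESHAPES `stub_items4` into the strictly
weaker `stub_items4G = SEET_η ∧ LCTF ∧ EAT_η ∧ CAT_η` and re-runs the five plumbing steps of the clock that consume the tails
(signed rate cubic channel, transfer-activity tails, one-window ledger, window continuity, ledger end) with the guard threaded
through — each a copy of the landed template with the packing threshold shrunk by one more `min`.

This file DECLARES the statements of v19 (registered stub signatures of the line, route-internal, not cited facts):
* `SuperExponentialEnergyTailsGuarded` (SEET_η), `EnergyActivityTailsGuarded` (EAT_η), `CollisionActivityTailsGuarded` (CAT_η —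
  the text `CAT_eta.txt` of the 13734 restate request verbatim), `EnergyCurrentTailsGuarded` (ECT_η), `TransferActivityTailsGuarded`
  (TAT_η): the route items / dock inputs with the hypothesis `∀ t' ∈ [0,T), ∀ x, ρ t' x · σ³ < η₀` inserted after the solution and
  `∃ η₀ > 0` outermost — the shape of the conjunct `_root_.HydrodynamicLimit`;
* `OneWindowLedgerRateD` — the common conclusion of `HydroLimitInBandSignedBand.WindowClauseRateS` and first antecedent of
  `ClampedTransferDockLedgerEndD.LedgerEndD` (there inlined twice; named here once, verbatim);
* `CubicChannelRateSGuarded`, `WindowClauseRateSGuarded`, `WindowContinuityInBandGuarded`, `LedgerEndDGuarded` — the plumbing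
  statements of v19: the landed `CubicChannelRateS` / `WindowClauseRateS` / `ClampedCurrentsDockFromWindows.WindowContinuityInBand` /
  `LedgerEndD` with the guarded tails as antecedents (the window continuity acquires its own packing threshold `ηW`);
and proves that each guarded input is IMPLIED by its unguarded original (`…_of_unguarded`, `η₀ := 1`), so that v19 is a
weakening of v18 stub by stub.

References: H.-T. Yau, Lett. Math. Phys. 22 (1991) §2; S. Olla, S. R. S. Varadhan, H.-T. Yau, Comm. Math. Phys. 155 (1993) §3.
prover-line-stmt-AtomisticToContinuum-17372-c13-0 (lead, line cycle 14).
-/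

noncomputable section

open MeasureTheory Filter Set Topology InformationTheory
open scoped ENNReal

namespace Summit.AtomisticToContinuum.HydrodynamicLimit.Theorems.HydroLimitGuardedInputs

open Literature.MathematicalPhysics.KineticTheory Literature.Analysis.FluidPDE Literature.Analysis.FunctionSpaces
open Summit.AtomisticToContinuum.HydrodynamicLimit.Theses
open Summit.AtomisticToContinuum.HydrodynamicLimit.Theorems
open Summit.AtomisticToContinuum.HydrodynamicLimit.Theorems.HydroLimitInBandSignedBand
  (KineticCurrentsLDAlongFamiliesQ BandShiftStatics KineticInstanceOrth)

/-! ## §1 The guard-relativised true-law tails -/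

/-- registered stub signature (conjunct 1 of `stub_items4G`) of line IdeatorOneSketch, crux HydroLimitProfilewiseBand
(stmt-AtomisticToContinuum-17372) — route-internal, not a cited fact.
**SEET_η — super-exponential cubic velocity tails under the true pre-shock law, GUARD-RELATIVISED**: the route item
`OneFlightGossipEngine.SuperExponentialEnergyTails` (stmt-17701) verbatim, asked only of classical solutions obeying the packing
guard `ρ_{t′}(x) σ³ < η₀` on `[0, T)`, `∃ η₀ > 0` outermost. -/
def SuperExponentialEnergyTailsGuarded : Prop :=
  ∃ η₀ : ℝ, 0 < η₀ ∧
  ∀ (a₀ θ₀ : T3 → ℝ) (u₀ : T3 → V3), Continuous a₀ → Continuous θ₀ → Continuous u₀ → (∀ x, 0 < a₀ x) →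
    (∀ x, 0 < θ₀ x) → ∃ σ₀ : ℝ, 0 < σ₀ ∧ ∀ σ : ℝ, 0 < σ → σ < σ₀ →
    ∀ (T : ℝ) (ρ θ : ℝ → T3 → ℝ) (u : ℝ → T3 → V3), IsHardSphereEulerSolution σ T ρ u θ →
    (∀ t' ∈ Set.Ico 0 T, ∀ x, ρ t' x * σ ^ 3 < η₀) →
    ∀ Φ : (N : ℕ) → HardSphereFlow (Torus.geometry (Fin 3)) (hsDiameter σ N) (N + 1),
    TendstoHydroFieldsAt (fun N => localGibbsLaw σ a₀ u₀ θ₀ N (Φ N)) Φ ρ u θ 0 →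
    ∀ t ∈ Set.Ico 0 T, ∀ c : ℝ, 0 < c → ∃ K₀ : ℝ, 0 < K₀ ∧ ∀ K : ℝ, K₀ ≤ K → ∀ ε : ℝ, 0 < ε →
    ∃ N₀ : ℕ, ∀ N : ℕ, N₀ ≤ N → ∀ s ∈ Set.Icc 0 t,
      ∫⁻ z, ENNReal.ofReal (((N : ℝ) + 1)⁻¹ * ∑ i : Fin (N + 1),
          Set.indicator {v : V3 | K < ‖v‖} (fun v => ‖v‖ ^ 3) (((Φ N).flow s z i).2))
        ∂(localGibbsLaw σ a₀ u₀ θ₀ N (Φ N)) ≤ ENNReal.ofReal (Real.exp (-(c * K)) + ε)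

/-- registered stub signature (conjunct 3 of `stub_items4G`) of line IdeatorOneSketch, crux HydroLimitProfilewiseBand
(stmt-AtomisticToContinuum-17372) — route-internal, not a cited fact.
**EAT_η — a-priori L¹ tails of the window ENERGY-transfer activity under the true pre-shock law, GUARD-RELATIVISED**: the route
item `OneFlightGossipEngine.EnergyActivityTails` (stmt-17703; = the heart's `CollisionEnergyActivityTails`) verbatim, asked only of
classical solutions obeying the packing guard on `[0, T)`, `∃ η₀ > 0` outermost. -/
def EnergyActivityTailsGuarded : Prop :=
  ∃ η₀ : ℝ, 0 < η₀ ∧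
  ∀ (a₀ θ₀ : T3 → ℝ) (u₀ : T3 → V3), Continuous a₀ → Continuous θ₀ → Continuous u₀ → (∀ x, 0 < a₀ x) →
    (∀ x, 0 < θ₀ x) → ∃ σ₀ : ℝ, 0 < σ₀ ∧ ∀ σ : ℝ, 0 < σ → σ < σ₀ →
    ∀ (T : ℝ) (ρ θ : ℝ → T3 → ℝ) (u : ℝ → T3 → V3), IsHardSphereEulerSolution σ T ρ u θ →
    (∀ t' ∈ Set.Ico 0 T, ∀ x, ρ t' x * σ ^ 3 < η₀) →
    ∀ Φ : (N : ℕ) → HardSphereFlow (Torus.geometry (Fin 3)) (hsDiameter σ N) (N + 1),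
    TendstoHydroFieldsAt (fun N => localGibbsLaw σ a₀ u₀ θ₀ N (Φ N)) Φ ρ u θ 0 →
    ∀ t ∈ Set.Ico 0 T, ∃ V₀ : ℝ, 0 < V₀ ∧ ∀ V : ℝ, V₀ ≤ V → ∀ ε : ℝ, 0 < ε → ∃ τ₀ : ℝ, 0 < τ₀ ∧
    ∀ τ : ℝ, τ₀ ≤ τ → ∃ N₀ : ℕ, ∀ N : ℕ, N₀ ≤ N → ∀ s ∈ Set.Icc 0 t,
      (let w : ℝ := τ * ((N : ℝ) + 1) ^ (-(1 / 3 : ℝ))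
       let P := localGibbsLaw σ a₀ u₀ θ₀ N (Φ N)
       let act := fun (i : Fin (N + 1)) z =>
         σ / τ * (Φ N).collisionSum (Set.Ioc s (s + w))
           (fun c => if c.fst = i then |‖c.postVel.1‖ ^ 2 - ‖c.preVel.1‖ ^ 2| / 2 else 0) z
       ∫⁻ z, ENNReal.ofReal (((N : ℝ) + 1)⁻¹ * ∑ i : Fin (N + 1),
           Set.indicator {y : ℝ | V < y} (fun y => y) (act i z)) ∂P ≤ ENNReal.ofReal ε)

/-- registered stub signature (conjunct 4 of `stub_items4G`) of line IdeatorOneSketch, crux HydroLimitProfilewiseBand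
(stmt-AtomisticToContinuum-17372) — route-internal, not a cited fact.
**CAT_η — a-priori L¹ tails of the window collisional MOMENTUM activity under the true pre-shock law, GUARD-RELATIVISED**: the
route item `OneFlightGossipEngine.CollisionActivityTails` (stmt-13734) verbatim, asked only of classical solutions obeying the
packing guard on `[0, T)`, `∃ η₀ > 0` outermost.  Byte-identical with the text `CAT_eta.txt` of the tenure restate request
`Cruxes/CollisionActivityTails/RESTATE-SPLIT-REQUEST.md` (crux-strategist of stmt-13734, 2026-08-17) and with
`Cruxes/CollisionActivityTails/StrategistSketch.lean: CollisionActivityTailsGuarded`. -/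
def CollisionActivityTailsGuarded : Prop :=
  ∃ η₀ : ℝ, 0 < η₀ ∧
  ∀ (a₀ θ₀ : T3 → ℝ) (u₀ : T3 → V3), Continuous a₀ → Continuous θ₀ → Continuous u₀ → (∀ x, 0 < a₀ x) →
    (∀ x, 0 < θ₀ x) → ∃ σ₀ : ℝ, 0 < σ₀ ∧ ∀ σ : ℝ, 0 < σ → σ < σ₀ →
    ∀ (T : ℝ) (ρ θ : ℝ → T3 → ℝ) (u : ℝ → T3 → V3), IsHardSphereEulerSolution σ T ρ u θ →
    (∀ t' ∈ Set.Ico 0 T, ∀ x, ρ t' x * σ ^ 3 < η₀) →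
    ∀ Φ : (N : ℕ) → HardSphereFlow (Torus.geometry (Fin 3)) (hsDiameter σ N) (N + 1),
    TendstoHydroFieldsAt (fun N => localGibbsLaw σ a₀ u₀ θ₀ N (Φ N)) Φ ρ u θ 0 →
    ∀ t ∈ Set.Ico 0 T, ∃ V₀ : ℝ, 0 < V₀ ∧ ∀ V : ℝ, V₀ ≤ V → ∀ ε : ℝ, 0 < ε → ∃ τ₀ : ℝ, 0 < τ₀ ∧
    ∀ τ : ℝ, τ₀ ≤ τ → ∃ N₀ : ℕ, ∀ N : ℕ, N₀ ≤ N → ∀ s ∈ Set.Icc 0 t,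
      (let w : ℝ := τ * ((N : ℝ) + 1) ^ (-(1 / 3 : ℝ))
       let P := localGibbsLaw σ a₀ u₀ θ₀ N (Φ N)
       let act := fun (i : Fin (N + 1)) (z : Config (N + 1) (Fin 3) T3) =>
         σ / τ * (Φ N).collisionSum (Set.Ioc s (s + w))
           (fun c => if c.fst = i then ‖c.postVel.1 - c.preVel.1‖ else 0) z
       ∫⁻ z, ENNReal.ofReal (((N : ℝ) + 1)⁻¹ * ∑ i : Fin (N + 1),
           Set.indicator {y : ℝ | V < y} (fun y => y) (act i z)) ∂P ≤ ENNReal.ofReal ε)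

/-- registered stub signature (output of `stub_energyCurrentTailsG`) of line IdeatorOneSketch, crux HydroLimitProfilewiseBand
(stmt-AtomisticToContinuum-17372) — route-internal, not a cited fact.
**ECT_η — uniform integrability of the cubic velocity tails under the true pre-shock law, GUARD-RELATIVISED**: the route item
`OneFlightGossipEngine.EnergyCurrentTails` (stmt-9235) verbatim, asked only of classical solutions obeying the packing guard on
`[0, T)`, `∃ η₀ > 0` outermost (follows from SEET_η at rate one). -/
def EnergyCurrentTailsGuarded : Prop :=
  ∃ η₀ : ℝ, 0 < η₀ ∧
  ∀ (a₀ θ₀ : T3 → ℝ) (u₀ : T3 → V3), Continuous a₀ → Continuous θ₀ → Continuous u₀ → (∀ x, 0 < a₀ x) →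
    (∀ x, 0 < θ₀ x) → ∃ σ₀ : ℝ, 0 < σ₀ ∧ ∀ σ : ℝ, 0 < σ → σ < σ₀ →
    ∀ (T : ℝ) (ρ θ : ℝ → T3 → ℝ) (u : ℝ → T3 → V3), IsHardSphereEulerSolution σ T ρ u θ →
    (∀ t' ∈ Set.Ico 0 T, ∀ x, ρ t' x * σ ^ 3 < η₀) →
    ∀ Φ : (N : ℕ) → HardSphereFlow (Torus.geometry (Fin 3)) (hsDiameter σ N) (N + 1),
    TendstoHydroFieldsAt (fun N => localGibbsLaw σ a₀ u₀ θ₀ N (Φ N)) Φ ρ u θ 0 →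
    ∀ t ∈ Set.Ico 0 T, ∀ ε : ℝ, 0 < ε → ∃ M : ℝ, ∃ N₀ : ℕ, ∀ N : ℕ, N₀ ≤ N → ∀ s ∈ Set.Icc 0 t,
      ∫⁻ z, ENNReal.ofReal (((N : ℝ) + 1)⁻¹ * ∑ i : Fin (N + 1),
          Set.indicator {v : V3 | M < ‖v‖} (fun v => ‖v‖ ^ 3) (((Φ N).flow s z i).2))
        ∂(localGibbsLaw σ a₀ u₀ θ₀ N (Φ N)) ≤ ENNReal.ofReal ε

/-- registered stub signature (output of `stub_transferActivityTailsG`) of line IdeatorOneSketch, crux HydroLimitProfilewiseBand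
(stmt-AtomisticToContinuum-17372) — route-internal, not a cited fact.
**TAT_η — L¹ tails of the combined window transfer activity (momentum impulse + energy transfer), GUARD-RELATIVISED**: the dock's
`ClampedCurrentsDockTransferTails.TransferActivityTails` verbatim with the packing guard on `[0, T)` inserted and `∃ η₀ > 0`
outermost (follows from CAT_η ∧ EAT_η by the pointwise splitting of the landed `stub_transferActivityTails`). -/
def TransferActivityTailsGuarded : Prop :=
  ∃ η₀ : ℝ, 0 < η₀ ∧
  ∀ (a₀ θ₀ : T3 → ℝ) (u₀ : T3 → V3), Continuous a₀ → Continuous θ₀ → Continuous u₀ → (∀ x, 0 < a₀ x) →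
    (∀ x, 0 < θ₀ x) → ∃ σ₀ : ℝ, 0 < σ₀ ∧ ∀ σ : ℝ, 0 < σ → σ < σ₀ →
    ∀ (T : ℝ) (ρ θ : ℝ → T3 → ℝ) (u : ℝ → T3 → V3), IsHardSphereEulerSolution σ T ρ u θ →
    (∀ t' ∈ Set.Ico 0 T, ∀ x, ρ t' x * σ ^ 3 < η₀) →
    ∀ Φ : (N : ℕ) → HardSphereFlow (Torus.geometry (Fin 3)) (hsDiameter σ N) (N + 1),
    TendstoHydroFieldsAt (fun N => localGibbsLaw σ a₀ u₀ θ₀ N (Φ N)) Φ ρ u θ 0 →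
    ∀ t ∈ Set.Ico 0 T, ∃ V₀ : ℝ, 0 < V₀ ∧ ∀ V : ℝ, V₀ ≤ V → ∀ ε : ℝ, 0 < ε → ∃ τ₀ : ℝ, 0 < τ₀ ∧
    ∀ τ : ℝ, τ₀ ≤ τ → ∃ N₀ : ℕ, ∀ N : ℕ, N₀ ≤ N → ∀ s ∈ Set.Icc 0 t,
      (let w : ℝ := τ * ((N : ℝ) + 1) ^ (-(1 / 3 : ℝ))
       let P := localGibbsLaw σ a₀ u₀ θ₀ N (Φ N)
       let act := fun (i : Fin (N + 1)) (z : Config (N + 1) (Fin 3) T3) =>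
         σ / τ * (Φ N).collisionSum (Set.Ioc s (s + w))
           (fun c => if c.fst = i then ‖c.postVel.1 - c.preVel.1‖ + |‖c.postVel.1‖ ^ 2 - ‖c.preVel.1‖ ^ 2| / 2 else 0) z
       ∫⁻ z, ENNReal.ofReal (((N : ℝ) + 1)⁻¹ * ∑ i : Fin (N + 1),
           Set.indicator {y : ℝ | V < y} (fun y => y) (act i z)) ∂P ≤ ENNReal.ofReal ε)

/-- Each guarded tail is implied by its unguarded original (ignore the guard; `η₀ := 1`): SEET ⇒ SEET_η. [folklore] -/
theorem superExponentialEnergyTailsGuarded_of_unguarded (h : OneFlightGossipEngine.SuperExponentialEnergyTails) :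
    SuperExponentialEnergyTailsGuarded := by
  refine ⟨1, one_pos, fun a₀ θ₀ u₀ ha hθ hu ha0 hθ0 => ?_⟩
  obtain ⟨σ₀, hσ₀, H⟩ := h a₀ θ₀ u₀ ha hθ hu ha0 hθ0
  exact ⟨σ₀, hσ₀, fun σ hσ hσlt T ρ θ u hsol _ Φ hLLN t ht => H σ hσ hσlt T ρ θ u hsol Φ hLLN t ht⟩

/-- EAT ⇒ EAT_η (ignore the guard). [folklore] -/
theorem energyActivityTailsGuarded_of_unguarded (h : OneFlightGossipEngine.EnergyActivityTails) :
    EnergyActivityTailsGuarded := by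
  refine ⟨1, one_pos, fun a₀ θ₀ u₀ ha hθ hu ha0 hθ0 => ?_⟩
  obtain ⟨σ₀, hσ₀, H⟩ := h a₀ θ₀ u₀ ha hθ hu ha0 hθ0
  exact ⟨σ₀, hσ₀, fun σ hσ hσlt T ρ θ u hsol _ Φ hLLN t ht => H σ hσ hσlt T ρ θ u hsol Φ hLLN t ht⟩

/-- CAT ⇒ CAT_η (ignore the guard; the kernel form of `StrategistSketch.guarded_of_collisionActivityTails`). [folklore] -/
theorem collisionActivityTailsGuarded_of_unguarded (h : OneFlightGossipEngine.CollisionActivityTails) :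
    CollisionActivityTailsGuarded := by
  refine ⟨1, one_pos, fun a₀ θ₀ u₀ ha hθ hu ha0 hθ0 => ?_⟩
  obtain ⟨σ₀, hσ₀, H⟩ := h a₀ θ₀ u₀ ha hθ hu ha0 hθ0
  exact ⟨σ₀, hσ₀, fun σ hσ hσlt T ρ θ u hsol _ Φ hLLN t ht => H σ hσ hσlt T ρ θ u hsol Φ hLLN t ht⟩

/-- ECT ⇒ ECT_η (ignore the guard). [folklore] -/
theorem energyCurrentTailsGuarded_of_unguarded (h : OneFlightGossipEngine.EnergyCurrentTails) :
    EnergyCurrentTailsGuarded := by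
  refine ⟨1, one_pos, fun a₀ θ₀ u₀ ha hθ hu ha0 hθ0 => ?_⟩
  obtain ⟨σ₀, hσ₀, H⟩ := h a₀ θ₀ u₀ ha hθ hu ha0 hθ0
  exact ⟨σ₀, hσ₀, fun σ hσ hσlt T ρ θ u hsol _ Φ hLLN t ht => H σ hσ hσlt T ρ θ u hsol Φ hLLN t ht⟩

/-- The heart's copy of EAT is the route item (both texts elaborate to one term). [folklore] -/
theorem collisionEnergyActivityTails_iff_item :
    HydroLimitInBandOfHeart.CollisionEnergyActivityTails ↔ OneFlightGossipEngine.EnergyActivityTails := Iff.rfl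

/-! ## §2 The plumbing statements of skeleton v19 (guarded antecedents; conclusions verbatim) -/

/-- registered stub signature (conclusion of `stub_windowClauseRateSG`, first antecedent of `stub_ledgerEndDG`) of line
IdeatorOneSketch, crux HydroLimitProfilewiseBand (stmt-AtomisticToContinuum-17372) — route-internal, not a cited fact.
**The one-window entropy ledger at a rate, D-shape, with the static telescoping clause** — the common CONCLUSION of the landed
`HydroLimitInBandSignedBand.WindowClauseRateS` / `ClampedTransferDockRate.WindowClauseRate` and the first antecedent of
`ClampedTransferDockLedgerEndD.LedgerEndD` (inlined there; named here, text verbatim): for an insertion factor `Rf` and uniform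
local-Gibbs concentration at `η₀`, a packing threshold `ηp` such that along every guarded tied classical solution and `t ∈ (0,T)`
there is a continuous static rate `Cst` telescoping `log Z_pos`, and for every target `δ` a rate `K`, an accuracy `ε` with
`4(1+t) ε e^{2Kt} ≤ δ`, a window `τ` and `N₀` beyond which every window `[s, s + τ(N+1)^{-1/3}] ⊆ [0,t]` obeys
`H_N(s+w) ≤ H_N(s) + K w sup_{[0,s+w]} H_N + w(N+1)ε + (log Z(s+w) − log Z(s)) + w(N+1)Cst(s)`. -/
def OneWindowLedgerRateD : Prop :=
  ∀ (r : ℝ) (Rf : ℝ → ℝ), 0 < r →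
    (∃ p : FormalMultilinearSeries ℝ ℝ ℝ, HasFPowerSeriesOnBall Rf p 0 (ENNReal.ofReal r)) →
    (∃ L : NNReal, LipschitzOnWith L Rf (Icc 0 r)) →
    (∀ x ∈ Ioo (-r) r, 0 < Rf x ∧ Rf x * (∑' j : ℕ, bE j / (j.factorial : ℝ) * (x * Rf x) ^ j) = 1) →
    (∀ x ∈ Icc 0 r, 1 ≤ Rf x ∧ Rf x ≤ 2) → ContinuousOn Rf (Icc 0 r) →
    (∀ x ∈ Ioo (-r) r, ∀ R ∈ Icc (1 / 2 : ℝ) 2,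
      R * (∑' j : ℕ, bE j / (j.factorial : ℝ) * (x * R) ^ j) = 1 → R = Rf x) →
    ∀ η₀ : ℝ, 0 < η₀ →
    (∀ (a θ₀ : T3 → ℝ) (u₀ : T3 → V3), Continuous a → Continuous θ₀ → Continuous u₀ → (∀ x, 0 < a x) →
      (∀ x, 0 < θ₀ x) → ∀ σ : ℝ, 0 < σ → σ ^ 3 * (⨆ x, a x) ≤ η₀ * ∫ x, a x →
      ∃ ρ₀ : T3 → ℝ, Continuous ρ₀ ∧ (∀ x, 0 < ρ₀ x) ∧
        (∀ (N : ℕ) (Φ : HardSphereFlow (Torus.geometry (Fin 3)) (hsDiameter σ N) (N + 1)),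
          IsProbabilityMeasure (localGibbsLaw σ a u₀ θ₀ N Φ)) ∧
        ∀ χ : T3 → ℝ, Continuous χ → ∀ δ : ℝ, 0 < δ → ∃ C : ℝ, 0 < C ∧
          ∀ (N : ℕ) (Φ : HardSphereFlow (Torus.geometry (Fin 3)) (hsDiameter σ N) (N + 1)),
            localGibbsLaw σ a u₀ θ₀ N Φ {z | δ < |empiricalDensityField z χ - ∫ x, χ x * ρ₀ x|} ≤
                ENNReal.ofReal (C * Real.exp (-(C⁻¹ * ((N : ℝ) + 1)))) ∧
              localGibbsLaw σ a u₀ θ₀ N Φ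
                  {z | δ < ‖empiricalMomentumField z χ - ∫ x, (χ x * ρ₀ x) • u₀ x‖} ≤
                ENNReal.ofReal (C * Real.exp (-(C⁻¹ * ((N : ℝ) + 1)))) ∧
              localGibbsLaw σ a u₀ θ₀ N Φ {z | δ < |empiricalEnergyField z χ -
                  ∫ x, χ x * totalEnergyDensity (ρ₀ x) (u₀ x) (θ₀ x)|} ≤
                ENNReal.ofReal (C * Real.exp (-(C⁻¹ * ((N : ℝ) + 1))))) →
    ∃ ηp : ℝ, 0 < ηp ∧
    ∀ (a₀ θ₀ : T3 → ℝ) (u₀ : T3 → V3), Continuous a₀ → Continuous θ₀ → Continuous u₀ →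
      (∀ x, 0 < a₀ x) → (∀ x, 0 < θ₀ x) →
      ∃ σ₀ : ℝ, 0 < σ₀ ∧ ∀ σ : ℝ, 0 < σ → σ < σ₀ →
        ∀ (T : ℝ) (ρ θ : ℝ → T3 → ℝ) (u : ℝ → T3 → V3), IsHardSphereEulerSolution σ T ρ u θ →
          (∀ s ∈ Set.Ico 0 T, ∀ x, ρ s x * σ ^ 3 < ηp) →
          ∀ Φ : (N : ℕ) → HardSphereFlow (Torus.geometry (Fin 3)) (hsDiameter σ N) (N + 1),
            TendstoHydroFieldsAt (fun N => localGibbsLaw σ a₀ u₀ θ₀ N (Φ N)) Φ ρ u θ 0 →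
            ∀ t ∈ Set.Ioo 0 T,
              ∃ Cst : ℝ → ℝ, ContinuousOn Cst (Set.Icc 0 t) ∧
                (∀ ε : ℝ, 0 < ε → ∃ N₀ : ℕ, ∀ N : ℕ, N₀ ≤ N → ∀ t' ∈ Set.Icc 0 t,
                  |Real.log (posPartition (fun x => ρ t' x * Rf (σ ^ 3 * ρ t' x)) (hsDiameter σ N) (N + 1)) -
                      Real.log (posPartition (fun x => ρ 0 x * Rf (σ ^ 3 * ρ 0 x)) (hsDiameter σ N) (N + 1)) +
                    ((N : ℝ) + 1) * ∫ r in (0 : ℝ)..t', Cst r| ≤ ((N : ℝ) + 1) * ε) ∧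
                ∀ δ : ℝ, 0 < δ → ∃ K : ℝ, 0 ≤ K ∧ ∃ ε : ℝ, 0 < ε ∧ 4 * (1 + t) * ε * Real.exp (2 * K * t) ≤ δ ∧
                ∃ τ : ℝ, 0 < τ ∧ ∃ N₀ : ℕ, ∀ N : ℕ, N₀ ≤ N →
                ∀ s : ℝ, 0 ≤ s → s + τ * ((N : ℝ) + 1) ^ (-(1 / 3 : ℝ)) ≤ t →
                (klDiv ((Φ N).lawAt (localGibbsLaw σ a₀ u₀ θ₀ N (Φ N)) (s + τ * ((N : ℝ) + 1) ^ (-(1 / 3 : ℝ))))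
                  (localGibbsLaw σ (fun x => ρ (s + τ * ((N : ℝ) + 1) ^ (-(1 / 3 : ℝ))) x *
                      Rf (σ ^ 3 * ρ (s + τ * ((N : ℝ) + 1) ^ (-(1 / 3 : ℝ))) x))
                    (u (s + τ * ((N : ℝ) + 1) ^ (-(1 / 3 : ℝ)))) (θ (s + τ * ((N : ℝ) + 1) ^ (-(1 / 3 : ℝ))))
                    N (Φ N))).toReal ≤
                (klDiv ((Φ N).lawAt (localGibbsLaw σ a₀ u₀ θ₀ N (Φ N)) s)
                  (localGibbsLaw σ (fun x => ρ s x * Rf (σ ^ 3 * ρ s x)) (u s) (θ s) N (Φ N))).toReal +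
                K * (τ * ((N : ℝ) + 1) ^ (-(1 / 3 : ℝ))) *
                  sSup ((fun s' => (klDiv ((Φ N).lawAt (localGibbsLaw σ a₀ u₀ θ₀ N (Φ N)) s')
                    (localGibbsLaw σ (fun x => ρ s' x * Rf (σ ^ 3 * ρ s' x)) (u s') (θ s') N (Φ N))).toReal) ''
                    Set.Icc 0 (s + τ * ((N : ℝ) + 1) ^ (-(1 / 3 : ℝ)))) +
                (τ * ((N : ℝ) + 1) ^ (-(1 / 3 : ℝ))) * ((N : ℝ) + 1) * ε +
                ((Real.log (posPartition (fun x => ρ (s + τ * ((N : ℝ) + 1) ^ (-(1 / 3 : ℝ))) x *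
                      Rf (σ ^ 3 * ρ (s + τ * ((N : ℝ) + 1) ^ (-(1 / 3 : ℝ))) x)) (hsDiameter σ N) (N + 1)) -
                    Real.log (posPartition (fun x => ρ s x * Rf (σ ^ 3 * ρ s x)) (hsDiameter σ N) (N + 1))) +
                  (τ * ((N : ℝ) + 1) ^ (-(1 / 3 : ℝ))) * ((N : ℝ) + 1) * Cst s)

/-- registered stub signature `stub_cubicChannelRateSG` of line IdeatorOneSketch, crux HydroLimitProfilewiseBand
(stmt-AtomisticToContinuum-17372) — route-internal, not a cited fact.
**The SIGNED rate cubic channel from SEET_η** — `HydroLimitInBandSignedBand.CubicChannelRateS` with its fourth antecedent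
`OneFlightGossipEngine.SuperExponentialEnergyTails` replaced by `SuperExponentialEnergyTailsGuarded`; conclusion verbatim (it is
already guarded by its own `ηQ`, which the proof shrinks below the guard of SEET_η). -/
def CubicChannelRateSGuarded : Prop :=
  BandShiftStatics → ClampedCurrentsDockCubicChannel.WindowFlowShift → KineticCurrentsLDAlongFamiliesQ →
  SuperExponentialEnergyTailsGuarded →
  ∀ (r : ℝ) (Rf : ℝ → ℝ), 0 < r → (∀ x ∈ Set.Icc 0 r, 1 ≤ Rf x ∧ Rf x ≤ 2) → ContinuousOn Rf (Set.Icc 0 r) →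
  ∃ ηQ : ℝ, 0 < ηQ ∧
  ∀ (a₀ θ₀ : T3 → ℝ) (u₀ : T3 → V3), Continuous a₀ → Continuous θ₀ → Continuous u₀ →
    (∀ x, 0 < a₀ x) → (∀ x, 0 < θ₀ x) →
    ∃ σ₀ : ℝ, 0 < σ₀ ∧ ∀ σ : ℝ, 0 < σ → σ < σ₀ →
    ∀ (T : ℝ) (ρ θ : ℝ → T3 → ℝ) (u : ℝ → T3 → V3), IsHardSphereEulerSolution σ T ρ u θ →
    (∀ s ∈ Set.Ico 0 T, ∀ x, ρ s x * σ ^ 3 < ηQ) →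
    ∀ Φ : (N : ℕ) → HardSphereFlow (Torus.geometry (Fin 3)) (hsDiameter σ N) (N + 1),
    TendstoHydroFieldsAt (fun N => localGibbsLaw σ a₀ u₀ θ₀ N (Φ N)) Φ ρ u θ 0 →
    ∀ t ∈ Set.Ico 0 T, ∃ Kstar : ℝ, 0 < Kstar ∧
    ∀ (G : ℝ → T3 × ℝ → ℝ) (C_G : ℝ), 0 ≤ C_G → ContinuousOn (Function.uncurry G) (Set.Icc 0 t ×ˢ Set.univ) →
    (∀ s ∈ Set.Icc 0 t, ∀ y : T3 × ℝ, 0 ≤ y.2 → |G s y| ≤ C_G) →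
    (∀ s ∈ Set.Icc 0 t, ∀ (x : T3) (s' : ℝ), s' ≤ Kstar ^ 2 → G s (x, s') = s' - 5 * θ s x) →
    (∀ s ∈ Set.Icc 0 t, ∀ (x : T3) (k : Fin 3),
      ∫ v, ((∑ j : Fin 3, Torus.partialDeriv j (θ s) x / (2 * (θ s x) ^ 2) * (v - u s x) j) *
          G s (x, ‖v - u s x‖ ^ 2)) * v k * localMaxwellian 1 (θ s x) (u s x) v = 0) →
    ∃ B : ℝ, 0 ≤ B ∧ ∀ c : ℝ, 0 < c → ∃ A : ℝ, 0 ≤ A ∧ ∃ K₀ : ℝ, 0 < K₀ ∧ ∀ K₁ : ℝ, K₀ ≤ K₁ →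
    ∀ ε : ℝ, 0 < ε → ∃ τ₀ : ℝ, 0 < τ₀ ∧ ∀ τ : ℝ, τ₀ ≤ τ → ∃ N₀ : ℕ, ∀ N : ℕ, N₀ ≤ N →
    ∀ s : ℝ, 0 ≤ s → s + τ * ((N : ℝ) + 1) ^ (-(1 / 3 : ℝ)) ≤ t →
      (let w : ℝ := τ * ((N : ℝ) + 1) ^ (-(1 / 3 : ℝ))
       let hi := fun (s : ℝ) (y : T3 × V3) =>
         (∑ k : Fin 3, Torus.partialDeriv k (θ s) y.1 / (2 * (θ s y.1) ^ 2) * (y.2 - u s y.1) k) *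
           (‖y.2 - u s y.1‖ ^ 2 - 5 * θ s y.1 - G s (y.1, ‖y.2 - u s y.1‖ ^ 2))
       ∫⁻ z, ENNReal.ofReal |∫ r in s..(s + w), ∑ i : Fin (N + 1), hi s ((Φ N).flow r z i)|
           ∂(localGibbsLaw σ a₀ u₀ θ₀ N (Φ N)) ≤
         ENNReal.ofReal (w * ((N : ℝ) + 1) * (ε + A * Real.exp (-(c * K₁))) +
           w * (B * K₁) * (klDiv ((Φ N).lawAt (localGibbsLaw σ a₀ u₀ θ₀ N (Φ N)) s)
             (localGibbsLaw σ (fun x => ρ s x * Rf (σ ^ 3 * ρ s x)) (u s) (θ s) N (Φ N))).toReal))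

/-- registered stub signature `stub_windowClauseRateSG` of line IdeatorOneSketch, crux HydroLimitProfilewiseBand
(stmt-AtomisticToContinuum-17372) — route-internal, not a cited fact.
**The one-window ledger at a rate, D-shape, over the signed cubic channel, from the GUARDED tails** —
`HydroLimitInBandSignedBand.WindowClauseRateS` with the antecedents `CubicChannelRateS`, SEET, CEAT, CAT, ECT replaced by
`CubicChannelRateSGuarded`, SEET_η, EAT_η, CAT_η, ECT_η; conclusion `OneWindowLedgerRateD` verbatim (its `ηp` shrinks below the
three guards). -/
def WindowClauseRateSGuarded : Prop :=
  ClampedTransferDockRate.WindowEstimateRate → CubicChannelRateSGuarded → BandShiftStatics → KineticInstanceOrth →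
    KineticCurrentsLDAlongFamiliesQ → SuperExponentialEnergyTailsGuarded →
    HydroLimitInBandOfHeart.LocalClampedTransferWindowLDFamily → EnergyActivityTailsGuarded →
    HydroLimitInBandOfHeart.KineticCurrentsWindowLDFamily →
    CollisionActivityTailsGuarded → EnergyCurrentTailsGuarded → OneWindowLedgerRateD

/-- registered stub signature (conclusion of `stub_windowContinuityInBandG`, second antecedent of `stub_ledgerEndDG`) of line
IdeatorOneSketch, crux HydroLimitProfilewiseBand (stmt-AtomisticToContinuum-17372) — route-internal, not a cited fact.
**Crude short-time continuity of the relative entropy along the explicit reference family, in band, WITH ITS OWN PACKING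
THRESHOLD** — `ClampedCurrentsDockFromWindows.WindowContinuityInBand` verbatim with `∃ ηW > 0` outermost and the guard
`∀ t' ∈ [0,T), ∀ x, ρ t' x · σ³ < ηW` inserted after the solution (the form CAT_η / EAT_η / ECT_η can serve; the landed statement is
the case `ηW = ∞`). -/
def WindowContinuityInBandGuarded : Prop :=
  ∃ ηW : ℝ, 0 < ηW ∧ ∀ (r : ℝ) (Rf : ℝ → ℝ), 0 < r → (∀ x ∈ Icc 0 r, 1 ≤ Rf x ∧ Rf x ≤ 2) →
    (∃ L : NNReal, LipschitzOnWith L Rf (Icc 0 r)) →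
    ∀ (a₀ θ₀ : T3 → ℝ) (u₀ : T3 → V3), Continuous a₀ → Continuous θ₀ → Continuous u₀ →
      (∀ x, 0 < a₀ x) → (∀ x, 0 < θ₀ x) →
      ∃ σ₀ : ℝ, 0 < σ₀ ∧ ∀ σ : ℝ, 0 < σ → σ < σ₀ →
        ∀ (T : ℝ) (ρ θ : ℝ → T3 → ℝ) (u : ℝ → T3 → V3), IsHardSphereEulerSolution σ T ρ u θ →
          (∀ t' ∈ Set.Ico 0 T, ∀ x, ρ t' x * σ ^ 3 < ηW) →
          ∀ Φ : (N : ℕ) → HardSphereFlow (Torus.geometry (Fin 3)) (hsDiameter σ N) (N + 1),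
            TendstoHydroFieldsAt (fun N => localGibbsLaw σ a₀ u₀ θ₀ N (Φ N)) Φ ρ u θ 0 →
            ∀ t ∈ Set.Ioo 0 T, (∀ s ∈ Set.Icc 0 t, ∀ x, ρ s x * σ ^ 3 < r) →
              ∀ τ : ℝ, 0 < τ → ∀ ε : ℝ, 0 < ε → ∃ N₀ : ℕ, ∀ N : ℕ, N₀ ≤ N →
                ∀ s ∈ Set.Icc 0 t, ∀ s' ∈ Set.Icc 0 t, s ≤ s' → s' ≤ s + τ * ((N : ℝ) + 1) ^ (-(1 / 3 : ℝ)) →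
                  |(klDiv ((Φ N).lawAt (localGibbsLaw σ a₀ u₀ θ₀ N (Φ N)) s')
                      (localGibbsLaw σ (fun x => ρ s' x * Rf (σ ^ 3 * ρ s' x)) (u s') (θ s') N (Φ N))).toReal -
                    (klDiv ((Φ N).lawAt (localGibbsLaw σ a₀ u₀ θ₀ N (Φ N)) s)
                      (localGibbsLaw σ (fun x => ρ s x * Rf (σ ^ 3 * ρ s x)) (u s) (θ s) N (Φ N))).toReal| ≤
                  ((N : ℝ) + 1) * ε

/-- registered stub signature `stub_ledgerEndDG` of line IdeatorOneSketch, crux HydroLimitProfilewiseBand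
(stmt-AtomisticToContinuum-17372) — route-internal, not a cited fact.
**The ledger end, D-shape, with the guarded window continuity** — `ClampedTransferDockLedgerEndD.LedgerEndD` with its second
antecedent `WindowContinuityInBand` replaced by `WindowContinuityInBandGuarded` (first antecedent named `OneWindowLedgerRateD`,
same text); consequent the heart's guarded Grönwall core verbatim. -/
def LedgerEndDGuarded : Prop :=
  OneWindowLedgerRateD → WindowContinuityInBandGuarded → ClampedCurrentsDockFromWindows.LedgerAprioriBound →
    HydroLimitInBandOfHeart.GronwallCoreInBand

/-- The landed window continuity (no threshold) gives the guarded one (`ηW := 1`, guard ignored). [folklore] -/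
theorem windowContinuityInBandGuarded_of_unguarded (h : ClampedCurrentsDockFromWindows.WindowContinuityInBand) :
    WindowContinuityInBandGuarded := by
  refine ⟨1, one_pos, fun r Rf hr hRf hRfL a₀ θ₀ u₀ ha hθ hu ha0 hθ0 => ?_⟩
  obtain ⟨σ₀, hσ₀, H⟩ := h r Rf hr hRf hRfL a₀ θ₀ u₀ ha hθ hu ha0 hθ0
  exact ⟨σ₀, hσ₀, fun σ hσ hσlt T ρ θ u hsol _ Φ hLLN t ht => H σ hσ hσlt T ρ θ u hsol Φ hLLN t ht⟩

/-- `WindowClauseRateS` concludes `OneWindowLedgerRateD` (the named conclusion is its text). [folklore] -/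
theorem windowClauseRateS_iff :
    HydroLimitInBandSignedBand.WindowClauseRateS ↔
      (ClampedTransferDockRate.WindowEstimateRate → HydroLimitInBandSignedBand.CubicChannelRateS → BandShiftStatics →
        KineticInstanceOrth → KineticCurrentsLDAlongFamiliesQ → OneFlightGossipEngine.SuperExponentialEnergyTails →
        HydroLimitInBandOfHeart.LocalClampedTransferWindowLDFamily → HydroLimitInBandOfHeart.CollisionEnergyActivityTails →
        HydroLimitInBandOfHeart.KineticCurrentsWindowLDFamily →
        OneFlightGossipEngine.CollisionActivityTails → OneFlightGossipEngine.EnergyCurrentTails → OneWindowLedgerRateD) :=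
  Iff.rfl

/-- `LedgerEndD` is `OneWindowLedgerRateD → WindowContinuityInBand → LedgerAprioriBound → GronwallCoreInBand`. [folklore] -/
theorem ledgerEndD_iff :
    ClampedTransferDockLedgerEndD.LedgerEndD ↔
      (OneWindowLedgerRateD → ClampedCurrentsDockFromWindows.WindowContinuityInBand →
        ClampedCurrentsDockFromWindows.LedgerAprioriBound → HydroLimitInBandOfHeart.GronwallCoreInBand) :=
  Iff.rfl

end Summit.AtomisticToContinuum.HydrodynamicLimit.Theorems.HydroLimitGuardedInputs

end
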